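import Literature.Analysis.FluidPDE.ElgindiTransportIBP
import Literature.Analysis.FluidPDE.ElgindiHkCoercivity
import HarnessLib

/-!
# The first transport estimate (Elgindi–Ghoul–Masmoudi, Proposition 9.4) for test functions
([ElgindiGhoulMasmoudi2021] §9 Proposition 9.4; [Elgindi2021] §8.1 Lemmas 8.7–8.8)

Topic `Literature/Analysis/FluidPDE`. Proof file (everything proved, no definitions, no named
facts) on the proof path of the named fact
`Literature.Analysis.FluidPDE.Elgindi.ElgindiGhoulMasmoudi2021_stabilityCore`
(`ElgindiStabilityDecomposition.lean`). Elgindi–Ghoul–Masmoudi, arXiv:1910.14071, §9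
Proposition 9.4 (p. 20): "`|(uD_θg, g)_{𝓗ᵏ}| ≤ (C/√(γ−1))|u|_{𝓗ᵏ}|g|²_{𝓗ᵏ}` and
`|(vD_zg, g)_{𝓗ᵏ}| ≤ (C/√(γ−1))|v|_{𝓗ᵏ}|g|²_{𝓗ᵏ}`"; T. M. Elgindi, arXiv:1904.04795, §8.1
Lemmas 8.7, 8.8 (p. 26), whose proofs are followed: Leibniz, `L^∞ × L²` on the factor with few
derivatives, the separated bound for `(D_z³f)(D_θ²g)`, and integration by parts in the term where
all derivatives fall on `g`.

Here at `k = 4` for test functions of the strip, for every weighted word pairing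
`∫∫ D^a(uD_θg)·D^ag·w²s^{−c}` (`|a| ≤ 4`, `c ∈ {0, η, γ}`, `c = γ ⇒ a₁ ≥ 1`) and then for the
`𝓗⁴`-type inner products `hkForm α 3 λ Λ` of `ElgindiHkCoercivity.lean`.
-/

noncomputable section

open MeasureTheory Set Function Real Filter Finset
open _root_.Topology
open scoped ENNReal ContDiff

namespace Literature.Analysis.FluidPDE

namespace Elgindi

/-! ### The separated bound with sharp orders -/

set_option maxHeartbeats 1600000 in
/-- **The separated bound for the awkward term, sharp orders** (refines `lintegral_awkward_le`, which
ends with the full functionals): `∫∫ w²(D_θu)²(D_z³v)²s^{−γ} ≤ (π/(3(γ−1)))‖D_θD_zu·W‖²‖D_θD_z³v·W‖²` —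
only the words `D_θD_zu` (order 2) and `D_θD_z³v` (order 4) enter, as needed for the transport
term `(D_z³f)(D_θ²g)` where `u = D_θg`. [cite: Elgindi2021, §8.1 proof of Lemma 8.7, the term (D_z³fD_θ²g, D_z³D_θg W²) (p. 26 of arXiv:1904.04795)] -/
theorem lintegral_awkward_le_mixed {α : ℝ} (hα : 0 < α) (hα10 : α ≤ 10) {u v : ℝ → ℝ → ℝ} (hu : StripTest u) (hv : StripTest v) :
    ∫⁻ p in strip, ENNReal.ofReal (radialWeight p.1 ^ 2 * (Dθ u p.1 p.2) ^ 2 * ((Dz^[3] v) p.1 p.2) ^ 2 * Real.sin (2 * p.2) ^ (-gammaExp α)) ≤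
      ENNReal.ofReal (π / (3 * (gammaExp α - 1))) * (eL2Sq (hkMixedTerm α 1 1 u) * eL2Sq (hkMixedTerm α 1 3 v)) := by
  set γ := gammaExp α with hγ
  have hγ1 : 1 < γ := by unfold gammaExp at hγ; rw [hγ]; linarith
  have hγ2 : γ ≤ 2 := by unfold gammaExp at hγ; rw [hγ]; linarith
  have hc1 : 0 ≤ π / (γ - 1) := div_nonneg Real.pi_pos.le (by linarith)
  have hv3 : StripTest (Dz^[3] v) := hv.ofWord 0 3
  -- the two parametric bounds
  set A : ℝ → ℝ≥0∞ := fun t => ∫⁻ s in Ioi (0:ℝ), ENNReal.ofReal ((Dz (dθ u) s t * radialWeight s) ^ 2 * Real.sin (2 * t) ^ (2 - γ)) with hA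
  set B : ℝ → ℝ≥0∞ := fun z => ∫⁻ τ in Ioo 0 (π / 2), ENNReal.ofReal (radialWeight z ^ 2 * dθ (Dz^[3] v) z τ ^ 2 * Real.sin (2 * τ) ^ (2 - γ)) with hB
  have mA' : Measurable fun q : ℝ × ℝ => ENNReal.ofReal ((Dz (dθ u) q.1 q.2 * radialWeight q.1) ^ 2 * Real.sin (2 * q.2) ^ (2 - γ)) := by
    have c1 : Measurable fun q : ℝ × ℝ => Dz (dθ u) q.1 q.2 := (hu.ofdθ.smooth.ofDz 0).continuous.measurable
    have c2 : Measurable fun q : ℝ × ℝ => radialWeight q.1 := by unfold radialWeight; fun_prop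
    have c3 : Measurable fun q : ℝ × ℝ => Real.sin (2 * q.2) ^ (2 - γ) := by fun_prop
    exact (((c1.mul c2).pow_const 2).mul c3).ennreal_ofReal
  have mB' : Measurable fun q : ℝ × ℝ => ENNReal.ofReal (radialWeight q.1 ^ 2 * dθ (Dz^[3] v) q.1 q.2 ^ 2 * Real.sin (2 * q.2) ^ (2 - γ)) := by
    have c1 : Measurable fun q : ℝ × ℝ => dθ (Dz^[3] v) q.1 q.2 := (hv3.ofdθ.smooth 0).continuous.measurable
    have c2 : Measurable fun q : ℝ × ℝ => radialWeight q.1 := by unfold radialWeight; fun_prop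
    have c3 : Measurable fun q : ℝ × ℝ => Real.sin (2 * q.2) ^ (2 - γ) := by fun_prop
    exact (((c2.pow_const 2).mul (c1.pow_const 2)).mul c3).ennreal_ofReal
  have mA : Measurable A := mA'.lintegral_prod_left' (μ := volume.restrict (Ioi (0:ℝ)))
  have mB : Measurable B := mB'.lintegral_prod_right' (ν := volume.restrict (Ioo (0:ℝ) (π / 2)))
  -- pointwise bound on the strip
  have hpt : ∀ p ∈ strip, ENNReal.ofReal (radialWeight p.1 ^ 2 * (Dθ u p.1 p.2) ^ 2 * ((Dz^[3] v) p.1 p.2) ^ 2 * Real.sin (2 * p.2) ^ (-γ)) ≤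
      (ENNReal.ofReal (1 / 3) * ENNReal.ofReal (π / (γ - 1))) * (B p.1 * A p.2) := by
    intro p hp
    have hs : 0 < Real.sin (2 * p.2) := Real.sin_pos_of_pos_of_lt_pi (by linarith [hp.2.1]) (by linarith [hp.2.2])
    have hst : 0 ≤ Real.sin (2 * p.2) ^ (2 - γ) := Real.rpow_nonneg hs.le _
    -- `w²(D_θu)²(D_z³v)²s^{-γ} = [(∂_θu)²] · [(D_z³v)²] · (w² s^{2-γ})`
    have e0 : radialWeight p.1 ^ 2 * (Dθ u p.1 p.2) ^ 2 * ((Dz^[3] v) p.1 p.2) ^ 2 * Real.sin (2 * p.2) ^ (-γ) =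
        (dθ u p.1 p.2 ^ 2) * (((Dz^[3] v) p.1 p.2) ^ 2 * radialWeight p.1 ^ 2 * Real.sin (2 * p.2) ^ (2 - γ)) := by
      rw [Dθ_apply, show deriv (fun θ' => u p.1 θ') p.2 = dθ u p.1 p.2 from rfl]
      have e := sin_pow_mul_rpow_neg hp 1 γ
      norm_num at e
      rw [← e]; ring
    rw [e0]
    have hX : dθ u p.1 p.2 ^ 2 ≤ 1 / 3 * ∫ s in Ioi (0:ℝ), (Dz (dθ u) s p.2 * radialWeight s) ^ 2 := hu.ofdθ.sq_le_radial p.1 p.2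
    have hY : ((Dz^[3] v) p.1 p.2) ^ 2 ≤ π / (γ - 1) * ∫ t in Ioo 0 (π / 2), dθ (Dz^[3] v) p.1 t ^ 2 * Real.sin (2 * t) ^ (2 - γ) := hv3.sq_le_angular hγ1 hγ2 p.1 p.2
    have hX0 : 0 ≤ ∫ s in Ioi (0:ℝ), (Dz (dθ u) s p.2 * radialWeight s) ^ 2 := setIntegral_nonneg measurableSet_Ioi fun s _ => sq_nonneg _
    have hY0 : 0 ≤ ∫ t in Ioo 0 (π / 2), dθ (Dz^[3] v) p.1 t ^ 2 * Real.sin (2 * t) ^ (2 - γ) :=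
      setIntegral_nonneg measurableSet_Ioo fun t ht => mul_nonneg (sq_nonneg _) (Real.rpow_nonneg (Real.sin_pos_of_pos_of_lt_pi (by linarith [ht.1]) (by linarith [ht.2])).le _)
    have hw0 : 0 ≤ radialWeight p.1 ^ 2 * Real.sin (2 * p.2) ^ (2 - γ) := by positivity
    -- real inequality, then to `ℝ≥0∞`
    have hreal : (dθ u p.1 p.2 ^ 2) * (((Dz^[3] v) p.1 p.2) ^ 2 * radialWeight p.1 ^ 2 * Real.sin (2 * p.2) ^ (2 - γ)) ≤
        (1 / 3 * (π / (γ - 1))) * (((radialWeight p.1 ^ 2 * ∫ t in Ioo 0 (π / 2), dθ (Dz^[3] v) p.1 t ^ 2 * Real.sin (2 * t) ^ (2 - γ))) *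
          ((∫ s in Ioi (0:ℝ), (Dz (dθ u) s p.2 * radialWeight s) ^ 2) * Real.sin (2 * p.2) ^ (2 - γ))) := by
      have h1 : ((Dz^[3] v) p.1 p.2) ^ 2 * radialWeight p.1 ^ 2 * Real.sin (2 * p.2) ^ (2 - γ) ≤
          (π / (γ - 1) * ∫ t in Ioo 0 (π / 2), dθ (Dz^[3] v) p.1 t ^ 2 * Real.sin (2 * t) ^ (2 - γ)) * radialWeight p.1 ^ 2 * Real.sin (2 * p.2) ^ (2 - γ) := by
        rw [mul_assoc, mul_assoc (π / (γ - 1) * _)]; exact mul_le_mul_of_nonneg_right hY hw0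
      calc (dθ u p.1 p.2 ^ 2) * (((Dz^[3] v) p.1 p.2) ^ 2 * radialWeight p.1 ^ 2 * Real.sin (2 * p.2) ^ (2 - γ))
          ≤ (1 / 3 * ∫ s in Ioi (0:ℝ), (Dz (dθ u) s p.2 * radialWeight s) ^ 2) *
              ((π / (γ - 1) * ∫ t in Ioo 0 (π / 2), dθ (Dz^[3] v) p.1 t ^ 2 * Real.sin (2 * t) ^ (2 - γ)) * radialWeight p.1 ^ 2 * Real.sin (2 * p.2) ^ (2 - γ)) :=
            mul_le_mul hX h1 (mul_nonneg (mul_nonneg (sq_nonneg _) (sq_nonneg _)) hst) (mul_nonneg (by norm_num) hX0)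
        _ = _ := by ring
    refine (ENNReal.ofReal_le_ofReal hreal).trans (le_of_eq ?_)
    have n1 : (0:ℝ) ≤ 1 / 3 * (π / (γ - 1)) := mul_nonneg (by norm_num) hc1
    have n2 : (0:ℝ) ≤ radialWeight p.1 ^ 2 * ∫ t in Ioo 0 (π / 2), dθ (Dz^[3] v) p.1 t ^ 2 * Real.sin (2 * t) ^ (2 - γ) := mul_nonneg (sq_nonneg _) hY0
    rw [ENNReal.ofReal_mul n1, ENNReal.ofReal_mul (by norm_num : (0:ℝ) ≤ 1 / 3), ENNReal.ofReal_mul n2]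
    congr 1
    -- `B p.1` and `A p.2` as `ofReal` of real integrals (continuous compactly supported integrands)
    have eB : ENNReal.ofReal (radialWeight p.1 ^ 2 * ∫ t in Ioo 0 (π / 2), dθ (Dz^[3] v) p.1 t ^ 2 * Real.sin (2 * t) ^ (2 - γ)) = B p.1 := by
      rw [hB]; simp only
      rw [← MeasureTheory.integral_const_mul]
      have e2 : ∀ t, radialWeight p.1 ^ 2 * (dθ (Dz^[3] v) p.1 t ^ 2 * Real.sin (2 * t) ^ (2 - γ)) = radialWeight p.1 ^ 2 * dθ (Dz^[3] v) p.1 t ^ 2 * Real.sin (2 * t) ^ (2 - γ) :=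
        fun t => by ring
      simp_rw [e2]
      refine ofReal_integral_eq_lintegral_ofReal ?_ ?_
      · have e3 : (fun t => radialWeight p.1 ^ 2 * dθ (Dz^[3] v) p.1 t ^ 2 * Real.sin (2 * t) ^ (2 - γ)) = fun t => radialWeight p.1 ^ 2 * (dθ (Dz^[3] v) p.1 t ^ 2 * Real.sin (2 * t) ^ (2 - γ)) := by
          funext t; ring
        rw [e3]
        refine Integrable.const_mul ?_ _
        have hc : ContinuousOn (fun t => dθ (Dz^[3] v) p.1 t ^ 2 * Real.sin (2 * t) ^ (2 - γ)) (Icc 0 (π / 2)) :=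
          ((((hv3.ofdθ.smooth 0).continuous.comp (Continuous.prodMk_right p.1)).pow 2).mul
            ((Real.continuous_sin.comp (continuous_const.mul continuous_id)).rpow_const fun _ => Or.inr (by linarith))).continuousOn
        exact hc.integrableOn_Icc.mono_set Ioo_subset_Icc_self
      · rw [Filter.EventuallyLE, ae_restrict_iff' measurableSet_Ioo]
        refine ae_of_all _ fun t ht => ?_
        have : 0 ≤ Real.sin (2 * t) ^ (2 - γ) := Real.rpow_nonneg (Real.sin_pos_of_pos_of_lt_pi (by linarith [ht.1]) (by linarith [ht.2])).le _
        show (0:ℝ) ≤ _; positivity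
    have eA : ENNReal.ofReal ((∫ s in Ioi (0:ℝ), (Dz (dθ u) s p.2 * radialWeight s) ^ 2) * Real.sin (2 * p.2) ^ (2 - γ)) = A p.2 := by
      rw [hA]; simp only
      rw [← MeasureTheory.integral_mul_const]
      refine ofReal_integral_eq_lintegral_ofReal ?_ (ae_of_all _ fun s => by show (0:ℝ) ≤ _; positivity)
      refine Integrable.mul_const ?_ _
      -- `s ↦ (D_z∂_θu(s,θ)·w(s))²` is continuous with compact support in `(0,∞)` (vanishes near `0`)
      obtain ⟨h1, h2, h3⟩ := hu.ofdθ.ofDz.slice_z p.2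
      obtain ⟨a, ha, hga, -⟩ := exists_pos_forall_lt_eq_zero h2 h3
      have hc : Continuous fun s => (Dz (dθ u) s p.2 * radialWeight s) ^ 2 := by
        have e : (fun s => (Dz (dθ u) s p.2 * radialWeight s) ^ 2) = fun s => radialWeight s ^ 2 * (Dz (dθ u) s p.2) ^ 2 := by funext s; ring
        rw [e]
        refine continuous_mul_of_eq_zero_lt (u := fun s => radialWeight s ^ 2) ?_ ((h1.continuous).pow 2) ha fun s hs => by simp [hga s hs]
        unfold radialWeight
        exact ContinuousOn.pow (ContinuousOn.div (by fun_prop) (by fun_prop) fun s hs => pow_ne_zero 2 hs) 2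
      have hcs : HasCompactSupport fun s => (Dz (dθ u) s p.2 * radialWeight s) ^ 2 := by
        have e : (fun s => (Dz (dθ u) s p.2 * radialWeight s) ^ 2) = fun s => (Dz (dθ u) s p.2) * (Dz (dθ u) s p.2 * radialWeight s ^ 2) := by funext s; ring
        rw [e]; exact h2.mul_right
      exact (hc.integrable_of_hasCompactSupport hcs).integrableOn
    rw [eB, eA]
  -- integrate: `∫∫ c·B(z)A(t) = c (∫B)(∫A)`
  have hmeas : Measurable fun p : ℝ × ℝ => ENNReal.ofReal (radialWeight p.1 ^ 2 * (Dθ u p.1 p.2) ^ 2 * ((Dz^[3] v) p.1 p.2) ^ 2 * Real.sin (2 * p.2) ^ (-γ)) := by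
    have c1 : Measurable fun q : ℝ × ℝ => Dθ u q.1 q.2 := (hu.ofDθ.smooth 0).continuous.measurable
    have c2 : Measurable fun q : ℝ × ℝ => radialWeight q.1 := by unfold radialWeight; fun_prop
    have c3 : Measurable fun q : ℝ × ℝ => Real.sin (2 * q.2) ^ (-γ) := by fun_prop
    have c4 : Measurable fun q : ℝ × ℝ => (Dz^[3] v) q.1 q.2 := (hv3.smooth 0).continuous.measurable
    exact ((((c2.pow_const 2).mul (c1.pow_const 2)).mul (c4.pow_const 2)).mul c3).ennreal_ofReal
  calc ∫⁻ p in strip, ENNReal.ofReal (radialWeight p.1 ^ 2 * (Dθ u p.1 p.2) ^ 2 * ((Dz^[3] v) p.1 p.2) ^ 2 * Real.sin (2 * p.2) ^ (-γ))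
      ≤ ∫⁻ p in strip, (ENNReal.ofReal (1 / 3) * ENNReal.ofReal (π / (γ - 1))) * (B p.1 * A p.2) := setLIntegral_mono' measurableSet_strip hpt
    _ = (ENNReal.ofReal (1 / 3) * ENNReal.ofReal (π / (γ - 1))) * ((∫⁻ z in Ioi 0, B z) * ∫⁻ t in Ioo 0 (π / 2), A t) := by
        rw [← lintegral_strip_tensor mB.aemeasurable mA.aemeasurable, ← lintegral_const_mul' _ _ (ENNReal.mul_ne_top ENNReal.ofReal_ne_top ENNReal.ofReal_ne_top)]
    _ = (ENNReal.ofReal (1 / 3) * ENNReal.ofReal (π / (γ - 1))) * (eL2Sq (hkMixedTerm α 1 3 v) * eL2Sq (hkMixedTerm α 1 1 u)) := by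
        congr 2
        · rw [hB, ← lintegral_strip_eq_radial_theta mB', eL2Sq_eq_lintegral_ofReal]
          refine setLIntegral_congr_fun measurableSet_strip fun q hq => ?_
          rw [sq_hkMixedTerm_one α 3 v hq]
        · rw [hA, ← lintegral_strip_eq_theta_radial mA', eL2Sq_eq_lintegral_ofReal]
          refine setLIntegral_congr_fun measurableSet_strip fun q hq => ?_
          rw [sq_hkMixedTerm_one_one hu.smooth hq]; congr 1; ring
    _ = ENNReal.ofReal (π / (3 * (gammaExp α - 1))) * (eL2Sq (hkMixedTerm α 1 1 u) * eL2Sq (hkMixedTerm α 1 3 v)) := by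
        rw [← ENNReal.ofReal_mul (by norm_num), mul_comm (eL2Sq (hkMixedTerm α 1 3 v))]
        congr 1; congr 1; rw [hγ]; field_simp

/-! ### The weighted pieces -/

/-- Reduction of the unweighted case `c = 0` to `c = η`: `s⁰ = 1 ≤ s^{−η}` on the strip. [folklore] -/
theorem rpow_neg_zero_le_rpow_neg_eta {p : ℝ × ℝ} (hp : p ∈ strip) : Real.sin (2 * p.2) ^ (-(0:ℝ)) ≤ Real.sin (2 * p.2) ^ (-eta) := by
  have hs : 0 < Real.sin (2 * p.2) := Real.sin_pos_of_pos_of_lt_pi (by linarith [hp.2.1]) (by linarith [hp.2.2])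
  rw [neg_zero, Real.rpow_zero]
  exact Real.one_le_rpow_of_pos_of_le_one_of_nonpos hs (Real.sin_le_one _) (by unfold eta; norm_num)

section pieces

variable {α : ℝ} (hα : 0 < α) (hα10 : α ≤ 10) {u g : ℝ → ℝ → ℝ} (hu : StripTest u) (hg : StripTest g)
include hα hα10 hu hg

omit hu in
/-- **The `g`-word piece**: `∫∫ w²(D^ag)²s^{−c} ≤ |g|²_{𝓗⁴}` for `|a| ≤ 4`, `c ∈ {0, η, γ}`,
`c = γ ⇒ a₁ ≥ 1`. [folklore] -/
theorem lintegral_wordZ_le {a₁ a₂ : ℕ} (ha : a₁ + a₂ ≤ 4) {c : ℝ} (hc : c = 0 ∨ c = eta ∨ c = gammaExp α) (hgood : c = gammaExp α → 1 ≤ a₁) :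
    ∫⁻ p in strip, ENNReal.ofReal (radialWeight p.1 ^ 2 * ((Dθ^[a₁] (Dz^[a₂] g)) p.1 p.2) ^ 2 * Real.sin (2 * p.2) ^ (-c)) ≤ eHkNormSq α 4 g := by
  have hg' := hg
  rcases hc with h0 | hc
  · subst h0
    have hη : (eta : ℝ) = eta ∨ eta = gammaExp α := Or.inl rfl
    refine le_trans (setLIntegral_mono' measurableSet_strip fun p hp => ENNReal.ofReal_le_ofReal
      (mul_le_mul_of_nonneg_left (rpow_neg_zero_le_rpow_neg_eta hp) (by positivity))) ?_
    exact lintegral_word_le hα hα10 ha hη (fun h => absurd h (by unfold eta gammaExp; intro h'; linarith)) (v := g)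
  · exact lintegral_word_le hα hα10 ha hc hgood (v := g)

/-- **The cross piece** `∫∫ w²(D^{(l,k)}u)²(D_θ^{a₁−l+1}D_z^{a₂−k}g)²s^{−c} ≤ (π/(3(γ−1)))|u|²|g|²` for
`(l,k) ≠ (0,0)`, `l ≤ a₁`, `k ≤ a₂`, `|a| ≤ 4`, `c ∈ {0,η,γ}`, `c = γ ⇒ a₁ ≥ 1` (sup on the factor
with at most two derivatives; the separated bound for `(D_z³u)(D_θ²g)`). [cite: Elgindi2021, §8.1 proof of Lemma 8.7 (p. 26 of arXiv:1904.04795)] -/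
theorem lintegral_cross_le {a₁ a₂ l k : ℕ} (ha : a₁ + a₂ ≤ 4) (hl : l ≤ a₁) (hk : k ≤ a₂) (hlk : ¬(l = 0 ∧ k = 0))
    {c : ℝ} (hc : c = 0 ∨ c = eta ∨ c = gammaExp α) (hgood : c = gammaExp α → 1 ≤ a₁) :
    ∫⁻ p in strip, ENNReal.ofReal (radialWeight p.1 ^ 2 * (((Dθ^[l] (Dz^[k] u)) p.1 p.2) * ((Dθ^[a₁ - l + 1] (Dz^[a₂ - k] g)) p.1 p.2)) ^ 2 *
      Real.sin (2 * p.2) ^ (-c)) ≤ ENNReal.ofReal (π / (3 * (gammaExp α - 1))) * (eHkNormSq α 4 u * eHkNormSq α 4 g) := by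
  -- reduce `c = 0` to `c = η`
  suffices H : ∀ c : ℝ, (c = eta ∨ c = gammaExp α) → (c = gammaExp α → 1 ≤ a₁) →
      ∫⁻ p in strip, ENNReal.ofReal (radialWeight p.1 ^ 2 * (((Dθ^[l] (Dz^[k] u)) p.1 p.2) * ((Dθ^[a₁ - l + 1] (Dz^[a₂ - k] g)) p.1 p.2)) ^ 2 *
        Real.sin (2 * p.2) ^ (-c)) ≤ ENNReal.ofReal (π / (3 * (gammaExp α - 1))) * (eHkNormSq α 4 u * eHkNormSq α 4 g) by
    rcases hc with h0 | hc
    · subst h0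
      refine le_trans (setLIntegral_mono' measurableSet_strip fun p hp => ENNReal.ofReal_le_ofReal
        (mul_le_mul_of_nonneg_left (rpow_neg_zero_le_rpow_neg_eta hp) (by positivity))) ?_
      exact H eta (Or.inl rfl) (fun h => absurd h (by unfold eta gammaExp; intro h'; linarith))
    · exact H c hc hgood
  intro c hc hgood
  by_cases h3 : a₁ + a₂ ≤ 3
  · -- total order `≤ 4`: the product-rule term bound
    exact lintegral_term_le hα hα10 hu hg (a₁ := l) (a₂ := k) (b₁ := a₁ - l + 1) (b₂ := a₂ - k) (by omega) hc (fun _ => by omega)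
  · have h4 : a₁ + a₂ = 4 := by omega
    by_cases hlk2 : l + k ≤ 2
    · -- sup on the `u`-factor
      exact lintegral_term_supLeft hα hα10 hu hlk2 (b₁ := a₁ - l + 1) (b₂ := a₂ - k) (by omega) hc (fun _ => by omega) hg
    · by_cases hL : c = gammaExp α → 1 ≤ l
      · -- sup on the `g`-factor (symmetric use of the one-sided lemma)
        have h := lintegral_term_supLeft hα hα10 hg (a₁ := a₁ - l + 1) (a₂ := a₂ - k) (by omega) (b₁ := l) (b₂ := k) (by omega) hc hL hu
        rw [mul_comm (eHkNormSq α 4 g)] at h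
        refine (le_of_eq ?_).trans h
        refine setLIntegral_congr_fun measurableSet_strip fun p _ => ?_
        congr 1; ring
      · -- the separated term `(D_z³u)(D_θ²g)` against `s^{-γ}`
        have hcγ : c = gammaExp α := by
          by_contra h; exact hL fun h' => absurd h' h
        have hl0 : l = 0 := by
          by_contra h; exact hL fun _ => Nat.one_le_iff_ne_zero.2 h
        subst hl0
        have ha1 : 1 ≤ a₁ := hgood hcγ
        have hk3 : k = 3 := by omega
        have ha2 : a₂ = 3 := by omega
        have ha1' : a₁ = 1 := by omega
        subst hk3; subst ha2; subst ha1'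
        rw [hcγ]
        -- `∫ w²(D_z³u)²(D_θ(D_θg))²s^{-γ}` by the separated bound with `(D_θg, u)`
        have hsep := lintegral_awkward_le_mixed hα hα10 hg.ofDθ hu
        have e : ∀ p ∈ strip, ENNReal.ofReal (radialWeight p.1 ^ 2 * (((Dθ^[0] (Dz^[3] u)) p.1 p.2) * ((Dθ^[1 - 0 + 1] (Dz^[3 - 3] g)) p.1 p.2)) ^ 2 * Real.sin (2 * p.2) ^ (-gammaExp α)) =
            ENNReal.ofReal (radialWeight p.1 ^ 2 * (Dθ (Dθ g) p.1 p.2) ^ 2 * ((Dz^[3] u) p.1 p.2) ^ 2 * Real.sin (2 * p.2) ^ (-gammaExp α)) := by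
          intro p _
          simp only [Function.iterate_zero, id_eq, Nat.sub_zero, Nat.sub_self, show 1 + 1 = 2 by rfl, Function.iterate_succ_apply', Function.iterate_zero]
          congr 1; ring
        rw [setLIntegral_congr_fun measurableSet_strip e]
        refine hsep.trans (mul_le_mul_right (mul_le_mul' ?_ ?_) _) |>.trans (le_of_eq (by rw [mul_comm (eHkNormSq α 4 g)]))
        · -- `‖D_θD_z(D_θg)W‖² = ‖D_θ²D_zg·W‖² ≤ E(g)`
          have hc' : ∀ p ∈ strip, hkMixedTerm α 1 1 (Dθ g) p.1 p.2 = hkMixedTerm α 2 1 g p.1 p.2 := by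
            intro p hp
            simp only [hkMixedTerm, Function.iterate_succ_apply', Function.iterate_zero, id_eq]
            congr 1
            exact Dθ_congr (fun q hq => (iterate_Dz_Dθ (N := 3) (hg.contDiffOn 3) (j := 1) (by norm_num) q hq)) hp
          rw [eL2Sq_congr_strip hc']
          exact eL2Sq_hkMixedTerm_le α (by norm_num) (by norm_num) g
        · exact eL2Sq_hkMixedTerm_le α le_rfl (by norm_num) u

/-! ### Real-valued forms: the `L^∞` constant and the two kinds of terms -/

omit hg in
/-- The real `L^∞` bound of a low word: `|D^{(a,b)}u(z,θ)| ≤ √((π/(3(γ−1)))·|u|²_{𝓗⁴})`, `a + b ≤ 2`. [folklore] -/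
theorem abs_word_le_sqrt {a b : ℕ} (hab : a + b ≤ 2) (z θ : ℝ) :
    |(Dθ^[a] (Dz^[b] u)) z θ| ≤ Real.sqrt (π / (3 * (gammaExp α - 1)) * (eHkNormSq α 4 u).toReal) := by
  have hγ : 0 < gammaExp α - 1 := by unfold gammaExp; linarith
  have hc0 : 0 ≤ π / (3 * (gammaExp α - 1)) := by positivity
  have h := sq_word_le_eHkNormSq hα hα10 hu hab z θ
  have htop : eHkNormSq α 4 u ≠ ⊤ := hu.eHkNormSq_lt_top.ne
  rw [← ENNReal.ofReal_toReal htop, ← ENNReal.ofReal_mul hc0, ENNReal.ofReal_le_ofReal_iff (mul_nonneg hc0 ENNReal.toReal_nonneg)] at h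
  rw [← Real.sqrt_sq_eq_abs]
  exact Real.sqrt_le_sqrt h

omit hu hα hα10 in
/-- The `g`-word piece as a real integral. [folklore] -/
theorem integral_wordZ_eq {a₁ a₂ : ℕ} (c : ℝ) :
    ∫ p in strip, ((Dθ^[a₁] (Dz^[a₂] g)) p.1 p.2) ^ 2 * radialWeight p.1 ^ 2 * Real.sin (2 * p.2) ^ (-c) =
      (∫⁻ p in strip, ENNReal.ofReal (radialWeight p.1 ^ 2 * ((Dθ^[a₁] (Dz^[a₂] g)) p.1 p.2) ^ 2 * Real.sin (2 * p.2) ^ (-c))).toReal := by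
  have hZ := hg.ofWord a₁ a₂
  have hi : Integrable fun p : ℝ × ℝ => ((Dθ^[a₁] (Dz^[a₂] g)) p.1 p.2) ^ 2 * radialWeight p.1 ^ 2 * Real.sin (2 * p.2) ^ (-c) := by
    have h := (hZ.mul hZ).mulOn (contDiffOn_weight_rpow (-c)) |>.integrable
    refine h.congr (ae_of_all _ fun p => ?_)
    simp only [Pi.mul_apply]; ring
  rw [integral_eq_lintegral_of_nonneg_ae ((ae_restrict_iff' measurableSet_strip).2 (ae_of_all _ fun p hp => ?_)) hi.restrict.aestronglyMeasurable]
  · congr 1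
    refine setLIntegral_congr_fun measurableSet_strip fun p _ => ?_
    congr 1; ring
  · have hs : 0 < Real.sin (2 * p.2) := Real.sin_pos_of_pos_of_lt_pi (by linarith [hp.2.1]) (by linarith [hp.2.2])
    have := Real.rpow_nonneg hs.le (-c)
    show (0:ℝ) ≤ _; positivity

omit hu in
/-- The `g`-word piece, real bound: `∫∫(D^ag)²w²s^{−c} ≤ E(g)`. [folklore] -/
theorem integral_wordZ_le {a₁ a₂ : ℕ} (ha : a₁ + a₂ ≤ 4) {c : ℝ} (hc : c = 0 ∨ c = eta ∨ c = gammaExp α) (hgood : c = gammaExp α → 1 ≤ a₁) :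
    ∫ p in strip, ((Dθ^[a₁] (Dz^[a₂] g)) p.1 p.2) ^ 2 * radialWeight p.1 ^ 2 * Real.sin (2 * p.2) ^ (-c) ≤ (eHkNormSq α 4 g).toReal := by
  rw [integral_wordZ_eq hg c]
  exact ENNReal.toReal_mono hg.eHkNormSq_lt_top.ne (lintegral_wordZ_le hα hα10 hg ha hc hgood)

/-- **The integration-by-parts term**: `|∫∫ u·D_θ(D^ag)·D^ag·w²s^{−c}| ≤ (½ + |1−c|)√(c₀E(u))·E(g)`,
`c₀ = π/(3(γ−1))`. [cite: Elgindi2021, §8.1 proof of Lemma 8.7 (p. 26 of arXiv:1904.04795)] -/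
theorem abs_integral_ibp_Dθ_le {a₁ a₂ : ℕ} (ha : a₁ + a₂ ≤ 4) {c : ℝ} (hc : c = 0 ∨ c = eta ∨ c = gammaExp α) (hgood : c = gammaExp α → 1 ≤ a₁) :
    |∫ p in strip, u p.1 p.2 * Dθ (Dθ^[a₁] (Dz^[a₂] g)) p.1 p.2 * (Dθ^[a₁] (Dz^[a₂] g)) p.1 p.2 * radialWeight p.1 ^ 2 * Real.sin (2 * p.2) ^ (-c)| ≤
      (1 / 2 + |1 - c|) * Real.sqrt (π / (3 * (gammaExp α - 1)) * (eHkNormSq α 4 u).toReal) * (eHkNormSq α 4 g).toReal := by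
  set Z := Dθ^[a₁] (Dz^[a₂] g) with hZdef
  have hZ : StripTest Z := hg.ofWord a₁ a₂
  set M := Real.sqrt (π / (3 * (gammaExp α - 1)) * (eHkNormSq α 4 u).toReal) with hM
  have hM0 : 0 ≤ M := Real.sqrt_nonneg _
  have hu0 : ∀ z θ, |u z θ| ≤ M := fun z θ => by have := abs_word_le_sqrt hα hα10 hu (a := 0) (b := 0) (by norm_num) z θ; exact this
  have hu1 : ∀ z θ, |Dθ u z θ| ≤ M := fun z θ => by have := abs_word_le_sqrt hα hα10 hu (a := 1) (b := 0) (by norm_num) z θ; exact this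
  rw [integral_transport_Dθ hu hZ c, abs_mul, show |(-(1 / 2) : ℝ)| = 1 / 2 by norm_num]
  -- `|∫ Z²W·h| ≤ (M + 2|1−c|M)·∫Z²W`
  have hI := integral_wordZ_le hα hα10 hg ha hc hgood
  have hi : Integrable (fun p : ℝ × ℝ => Z p.1 p.2 ^ 2 * radialWeight p.1 ^ 2 * Real.sin (2 * p.2) ^ (-c)) (volume.restrict strip) := by
    have h := (hZ.mul hZ).mulOn (contDiffOn_weight_rpow (-c)) |>.integrable
    exact (h.congr (ae_of_all _ fun p => by simp only [Pi.mul_apply]; ring)).integrableOn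
  have hbound : ∀ p ∈ strip, |Z p.1 p.2 ^ 2 * radialWeight p.1 ^ 2 * Real.sin (2 * p.2) ^ (-c) * (Dθ u p.1 p.2 + 2 * (1 - c) * Real.cos (2 * p.2) * u p.1 p.2)| ≤
      (M * (1 + 2 * |1 - c|)) * (Z p.1 p.2 ^ 2 * radialWeight p.1 ^ 2 * Real.sin (2 * p.2) ^ (-c)) := by
    intro p hp
    have hs : 0 < Real.sin (2 * p.2) := Real.sin_pos_of_pos_of_lt_pi (by linarith [hp.2.1]) (by linarith [hp.2.2])
    have hW : 0 ≤ Z p.1 p.2 ^ 2 * radialWeight p.1 ^ 2 * Real.sin (2 * p.2) ^ (-c) := by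
      have := Real.rpow_nonneg hs.le (-c); positivity
    rw [abs_mul, abs_of_nonneg hW, mul_comm]
    refine mul_le_mul_of_nonneg_right ?_ hW
    calc |Dθ u p.1 p.2 + 2 * (1 - c) * Real.cos (2 * p.2) * u p.1 p.2| ≤ |Dθ u p.1 p.2| + |2 * (1 - c) * Real.cos (2 * p.2) * u p.1 p.2| := abs_add_le _ _
      _ ≤ M + 2 * |1 - c| * 1 * M := by
          refine add_le_add (hu1 p.1 p.2) ?_
          rw [abs_mul, abs_mul, abs_mul, show |(2:ℝ)| = 2 by norm_num]
          exact mul_le_mul (mul_le_mul_of_nonneg_left (Real.abs_cos_le_one _) (by positivity)) (hu0 p.1 p.2) (abs_nonneg _) (by positivity)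
      _ = M * (1 + 2 * |1 - c|) := by ring
  have hle := norm_integral_le_of_norm_le (hi.const_mul (M * (1 + 2 * |1 - c|)))
    ((ae_restrict_iff' measurableSet_strip).2 (ae_of_all _ fun p hp => by
      rw [Real.norm_eq_abs]; exact hbound p hp))
  rw [Real.norm_eq_abs, MeasureTheory.integral_const_mul] at hle
  have hI0 : 0 ≤ ∫ p in strip, Z p.1 p.2 ^ 2 * radialWeight p.1 ^ 2 * Real.sin (2 * p.2) ^ (-c) :=
    setIntegral_nonneg measurableSet_strip fun p hp => by
      have hs : 0 < Real.sin (2 * p.2) := Real.sin_pos_of_pos_of_lt_pi (by linarith [hp.2.1]) (by linarith [hp.2.2])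
      have := Real.rpow_nonneg hs.le (-c); positivity
  calc 1 / 2 * |∫ p in strip, Z p.1 p.2 ^ 2 * radialWeight p.1 ^ 2 * Real.sin (2 * p.2) ^ (-c) * (Dθ u p.1 p.2 + 2 * (1 - c) * Real.cos (2 * p.2) * u p.1 p.2)|
      ≤ 1 / 2 * ((M * (1 + 2 * |1 - c|)) * ∫ p in strip, Z p.1 p.2 ^ 2 * radialWeight p.1 ^ 2 * Real.sin (2 * p.2) ^ (-c)) := by
        exact mul_le_mul_of_nonneg_left hle (by norm_num)
    _ ≤ 1 / 2 * ((M * (1 + 2 * |1 - c|)) * (eHkNormSq α 4 g).toReal) := by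
        refine mul_le_mul_of_nonneg_left (mul_le_mul_of_nonneg_left hI (by positivity)) (by norm_num)
    _ = (1 / 2 + |1 - c|) * M * (eHkNormSq α 4 g).toReal := by ring

/-- **The cross terms**: `|∫∫ X·Y·Z·w²s^{−c}| ≤ √(c₀E(u)E(g))·√E(g)` for `X = D^{(l,k)}u`,
`Y = D_θ^{a₁−l+1}D_z^{a₂−k}g`, `Z = D^ag`, `(l,k) ≠ (0,0)` (Cauchy–Schwarz and the cross piece). [folklore] -/
theorem abs_integral_cross_le {a₁ a₂ l k : ℕ} (ha : a₁ + a₂ ≤ 4) (hl : l ≤ a₁) (hk : k ≤ a₂) (hlk : ¬(l = 0 ∧ k = 0))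
    {c : ℝ} (hc : c = 0 ∨ c = eta ∨ c = gammaExp α) (hgood : c = gammaExp α → 1 ≤ a₁) :
    |∫ p in strip, (Dθ^[l] (Dz^[k] u)) p.1 p.2 * (Dθ^[a₁ - l + 1] (Dz^[a₂ - k] g)) p.1 p.2 * (Dθ^[a₁] (Dz^[a₂] g)) p.1 p.2 *
        radialWeight p.1 ^ 2 * Real.sin (2 * p.2) ^ (-c)| ≤
      Real.sqrt (π / (3 * (gammaExp α - 1)) * (eHkNormSq α 4 u).toReal * (eHkNormSq α 4 g).toReal) * Real.sqrt (eHkNormSq α 4 g).toReal := by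
  set X := Dθ^[l] (Dz^[k] u) with hX
  set Y := Dθ^[a₁ - l + 1] (Dz^[a₂ - k] g) with hY
  set Z := Dθ^[a₁] (Dz^[a₂] g) with hZ'
  have hXt : StripTest X := hu.ofWord l k
  have hYt : StripTest Y := hg.ofWord _ _
  have hZt : StripTest Z := hg.ofWord a₁ a₂
  have hγ : 0 < gammaExp α - 1 := by unfold gammaExp; linarith
  have hc0 : 0 ≤ π / (3 * (gammaExp α - 1)) := by positivity
  -- the two `ℝ≥0∞` pieces
  have hA := lintegral_cross_le hα hα10 hu hg ha hl hk hlk hc hgood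
  have hB := lintegral_wordZ_le hα hα10 hg ha hc hgood
  have hEu : eHkNormSq α 4 u ≠ ⊤ := hu.eHkNormSq_lt_top.ne
  have hEg : eHkNormSq α 4 g ≠ ⊤ := hg.eHkNormSq_lt_top.ne
  -- Hölder in `ℝ≥0∞`
  set F : ℝ × ℝ → ℝ≥0∞ := fun p => ENNReal.ofReal (|X p.1 p.2 * Y p.1 p.2| * (radialWeight p.1 * Real.sin (2 * p.2) ^ (-c / 2))) with hF
  set G : ℝ × ℝ → ℝ≥0∞ := fun p => ENNReal.ofReal (|Z p.1 p.2| * (radialWeight p.1 * Real.sin (2 * p.2) ^ (-c / 2))) with hG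
  have mw : Measurable fun q : ℝ × ℝ => radialWeight q.1 * Real.sin (2 * q.2) ^ (-c / 2) := by unfold radialWeight; fun_prop
  have cX : Measurable fun q : ℝ × ℝ => X q.1 q.2 := (hXt.smooth 0).continuous.measurable
  have cY : Measurable fun q : ℝ × ℝ => Y q.1 q.2 := (hYt.smooth 0).continuous.measurable
  have cZ : Measurable fun q : ℝ × ℝ => Z q.1 q.2 := (hZt.smooth 0).continuous.measurable
  have mF : AEMeasurable F (volume.restrict strip) := by
    have : Measurable fun q : ℝ × ℝ => |X q.1 q.2 * Y q.1 q.2| * (radialWeight q.1 * Real.sin (2 * q.2) ^ (-c / 2)) :=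
      (continuous_abs.measurable.comp (cX.mul cY)).mul mw
    exact this.ennreal_ofReal.aemeasurable
  have mG : AEMeasurable G (volume.restrict strip) := by
    have : Measurable fun q : ℝ × ℝ => |Z q.1 q.2| * (radialWeight q.1 * Real.sin (2 * q.2) ^ (-c / 2)) :=
      (continuous_abs.measurable.comp cZ).mul mw
    exact this.ennreal_ofReal.aemeasurable
  have hsq : ∀ p ∈ strip, ∀ x : ℝ, ENNReal.ofReal (|x| * (radialWeight p.1 * Real.sin (2 * p.2) ^ (-c / 2))) ^ (2:ℝ) =
      ENNReal.ofReal (radialWeight p.1 ^ 2 * x ^ 2 * Real.sin (2 * p.2) ^ (-c)) := by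
    intro p hp x
    have hs : 0 < Real.sin (2 * p.2) := Real.sin_pos_of_pos_of_lt_pi (by linarith [hp.2.1]) (by linarith [hp.2.2])
    have hsc : 0 ≤ Real.sin (2 * p.2) ^ (-c / 2) := Real.rpow_nonneg hs.le (-c / 2)
    have hw0 : 0 ≤ radialWeight p.1 := (radialWeight_pos hp.1).le
    have h0 : 0 ≤ |x| * (radialWeight p.1 * Real.sin (2 * p.2) ^ (-c / 2)) := mul_nonneg (abs_nonneg _) (mul_nonneg hw0 hsc)
    have e2 : ENNReal.ofReal (|x| * (radialWeight p.1 * Real.sin (2 * p.2) ^ (-c / 2))) ^ (2:ℝ) = ENNReal.ofReal (|x| * (radialWeight p.1 * Real.sin (2 * p.2) ^ (-c / 2))) ^ (2:ℕ) := by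
      rw [show (2:ℝ) = ((2:ℕ) : ℝ) by norm_num, ENNReal.rpow_natCast]
    rw [e2, ← ENNReal.ofReal_pow h0]
    congr 1
    have e : (Real.sin (2 * p.2) ^ (-c / 2)) ^ 2 = Real.sin (2 * p.2) ^ (-c) := by
      rw [← Real.rpow_natCast, ← Real.rpow_mul hs.le]; norm_num
    rw [mul_pow, mul_pow, sq_abs, e]; ring
  have hHolder := ENNReal.lintegral_mul_le_Lp_mul_Lq (volume.restrict strip) Real.HolderConjugate.two_two mF mG
  have eFG : ∀ p ∈ strip, (F * G) p = ENNReal.ofReal (|X p.1 p.2 * Y p.1 p.2 * Z p.1 p.2 * radialWeight p.1 ^ 2 * Real.sin (2 * p.2) ^ (-c)|) := by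
    intro p hp
    have hs : 0 < Real.sin (2 * p.2) := Real.sin_pos_of_pos_of_lt_pi (by linarith [hp.2.1]) (by linarith [hp.2.2])
    have hsc : 0 ≤ Real.sin (2 * p.2) ^ (-c / 2) := Real.rpow_nonneg hs.le (-c / 2)
    have hw0 : 0 ≤ radialWeight p.1 := (radialWeight_pos hp.1).le
    have hr : 0 ≤ radialWeight p.1 * Real.sin (2 * p.2) ^ (-c / 2) := mul_nonneg hw0 hsc
    simp only [Pi.mul_apply, hF, hG]
    rw [← ENNReal.ofReal_mul (mul_nonneg (abs_nonneg _) hr)]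
    congr 1
    have e : (Real.sin (2 * p.2) ^ (-c / 2)) * (Real.sin (2 * p.2) ^ (-c / 2)) = Real.sin (2 * p.2) ^ (-c) := by
      rw [← Real.rpow_add hs]; ring_nf
    have hWnn : 0 ≤ radialWeight p.1 ^ 2 * Real.sin (2 * p.2) ^ (-c) := mul_nonneg (sq_nonneg _) (Real.rpow_nonneg hs.le (-c))
    have eabs : |X p.1 p.2 * Y p.1 p.2 * Z p.1 p.2 * radialWeight p.1 ^ 2 * Real.sin (2 * p.2) ^ (-c)| =
        |X p.1 p.2 * Y p.1 p.2| * |Z p.1 p.2| * (radialWeight p.1 ^ 2 * Real.sin (2 * p.2) ^ (-c)) := by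
      rw [show X p.1 p.2 * Y p.1 p.2 * Z p.1 p.2 * radialWeight p.1 ^ 2 * Real.sin (2 * p.2) ^ (-c) =
        (X p.1 p.2 * Y p.1 p.2) * Z p.1 p.2 * (radialWeight p.1 ^ 2 * Real.sin (2 * p.2) ^ (-c)) by ring,
        abs_mul, abs_mul (X p.1 p.2 * Y p.1 p.2), abs_of_nonneg hWnn]
    rw [eabs, ← e]; ring
  have eF2 : ∫⁻ p in strip, F p ^ (2:ℝ) = ∫⁻ p in strip, ENNReal.ofReal (radialWeight p.1 ^ 2 * (X p.1 p.2 * Y p.1 p.2) ^ 2 * Real.sin (2 * p.2) ^ (-c)) :=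
    setLIntegral_congr_fun measurableSet_strip fun p hp => hsq p hp _
  have eG2 : ∫⁻ p in strip, G p ^ (2:ℝ) = ∫⁻ p in strip, ENNReal.ofReal (radialWeight p.1 ^ 2 * (Z p.1 p.2) ^ 2 * Real.sin (2 * p.2) ^ (-c)) :=
    setLIntegral_congr_fun measurableSet_strip fun p hp => hsq p hp _
  rw [setLIntegral_congr_fun measurableSet_strip eFG, eF2, eG2] at hHolder
  -- the real integral is bounded by the `ℝ≥0∞` one
  have h1 : |∫ p in strip, X p.1 p.2 * Y p.1 p.2 * Z p.1 p.2 * radialWeight p.1 ^ 2 * Real.sin (2 * p.2) ^ (-c)| ≤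
      (∫⁻ p in strip, ENNReal.ofReal (|X p.1 p.2 * Y p.1 p.2 * Z p.1 p.2 * radialWeight p.1 ^ 2 * Real.sin (2 * p.2) ^ (-c)|)).toReal := by
    have := norm_integral_le_lintegral_norm (μ := volume.restrict strip) (fun p : ℝ × ℝ => X p.1 p.2 * Y p.1 p.2 * Z p.1 p.2 * radialWeight p.1 ^ 2 * Real.sin (2 * p.2) ^ (-c))
    rw [Real.norm_eq_abs] at this
    refine this.trans (le_of_eq ?_)
    congr 1
  refine h1.trans ?_
  have hfinA : ENNReal.ofReal (π / (3 * (gammaExp α - 1))) * (eHkNormSq α 4 u * eHkNormSq α 4 g) ≠ ⊤ :=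
    ENNReal.mul_ne_top ENNReal.ofReal_ne_top (ENNReal.mul_ne_top hEu hEg)
  have h2 := hHolder.trans (mul_le_mul' (ENNReal.rpow_le_rpow hA (by norm_num)) (ENNReal.rpow_le_rpow hB (by norm_num)))
  refine (ENNReal.toReal_mono (ENNReal.mul_ne_top (ENNReal.rpow_ne_top_of_nonneg (by norm_num) hfinA) (ENNReal.rpow_ne_top_of_nonneg (by norm_num) hEg)) h2).trans (le_of_eq ?_)
  rw [ENNReal.toReal_mul, ← ENNReal.toReal_rpow, ← ENNReal.toReal_rpow, ENNReal.toReal_mul, ENNReal.toReal_mul, ENNReal.toReal_ofReal hc0,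
    Real.sqrt_eq_rpow, Real.sqrt_eq_rpow, mul_assoc]

/-! ### The word pairing `∫∫ D^a(uD_θg)·D^ag·w²s^{−c}` -/

omit hα hα10 hu in
/-- Words of `D_θg` on the strip: `D_θ^iD_z^j(D_θg) = D_θ^{i+1}D_z^jg`. [folklore] -/
theorem word_Dθ_strip (i j : ℕ) {p : ℝ × ℝ} (hp : p ∈ strip) :
    (Dθ^[i] (Dz^[j] (Dθ g))) p.1 p.2 = (Dθ^[i + 1] (Dz^[j] g)) p.1 p.2 := by
  rw [Function.iterate_succ_apply]
  exact iterate_Dθ_congr (fun q hq => iterate_Dz_Dθ (N := j + 2) (hg.contDiffOn (j + 2)) le_rfl q hq) i p hp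

omit hα hα10 hu hg in
/-- Integrability of `X·Y·Z·w²s^{−c}` for test functions `X, Y, Z`. [folklore] -/
theorem integrable_XYZW {X Y Z : ℝ → ℝ → ℝ} (hX : StripTest X) (hY : StripTest Y) (hZ : StripTest Z) (c : ℝ) :
    Integrable (fun p : ℝ × ℝ => X p.1 p.2 * Y p.1 p.2 * Z p.1 p.2 * radialWeight p.1 ^ 2 * Real.sin (2 * p.2) ^ (-c)) (volume.restrict strip) := by
  have h := ((hX.mul hY).mul hZ).mulOn (contDiffOn_weight_rpow (-c)) |>.integrable
  exact (h.congr (ae_of_all _ fun p => by simp only [Pi.mul_apply]; ring)).integrableOn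

/-- **The `D_θ`-transport word pairing** (Elgindi Lemma 8.7 / EGM Proposition 9.4, one word): for test
functions `u, g`, `|a| ≤ 4`, `c ∈ {0,η,γ}` with `c = γ ⇒ a₁ ≥ 1`,
`|∫∫ D^a(uD_θg)·D^ag·w²s^{−c}| ≤ 16000·√(c₀|u|²_{𝓗⁴})·|g|²_{𝓗⁴}`, `c₀ = π/(3(γ−1))`. [cite: ElgindiGhoulMasmoudi2021, §9 Proposition 9.4 (p. 20 of arXiv:1910.14071); Elgindi2021, §8.1 Lemma 8.7 (p. 26 of arXiv:1904.04795)] -/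
theorem abs_wordPairing_Dθ_le {a₁ a₂ : ℕ} (ha : a₁ + a₂ ≤ 4) {c : ℝ} (hc : c = 0 ∨ c = eta ∨ c = gammaExp α) (hgood : c = gammaExp α → 1 ≤ a₁) :
    |∫ p in strip, (Dθ^[a₁] (Dz^[a₂] (u * Dθ g))) p.1 p.2 * (Dθ^[a₁] (Dz^[a₂] g)) p.1 p.2 * radialWeight p.1 ^ 2 * Real.sin (2 * p.2) ^ (-c)| ≤
      16000 * Real.sqrt (π / (3 * (gammaExp α - 1)) * (eHkNormSq α 4 u).toReal) * (eHkNormSq α 4 g).toReal := by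
  set S := Real.sqrt (π / (3 * (gammaExp α - 1)) * (eHkNormSq α 4 u).toReal) with hS
  set Eg := (eHkNormSq α 4 g).toReal with hEg
  have hS0 : 0 ≤ S := Real.sqrt_nonneg _
  have hEg0 : 0 ≤ Eg := ENNReal.toReal_nonneg
  have hc1 : |1 - c| ≤ 1 := by
    have hγ2 : gammaExp α ≤ 2 := by unfold gammaExp; linarith
    have hγ1 : 1 ≤ gammaExp α := by unfold gammaExp; linarith
    rcases hc with h | h | h <;> rw [h] <;> [norm_num; (unfold eta; norm_num); (rw [abs_le]; constructor <;> linarith)]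
  set Z := Dθ^[a₁] (Dz^[a₂] g) with hZ
  -- the terms of the Leibniz expansion
  set term : ℕ → ℕ → ℝ := fun k l => ∫ p in strip, (Dθ^[l] (Dz^[k] u)) p.1 p.2 * (Dθ^[a₁ - l + 1] (Dz^[a₂ - k] g)) p.1 p.2 * Z p.1 p.2 *
    radialWeight p.1 ^ 2 * Real.sin (2 * p.2) ^ (-c) with hterm
  have hexp : ∫ p in strip, (Dθ^[a₁] (Dz^[a₂] (u * Dθ g))) p.1 p.2 * Z p.1 p.2 * radialWeight p.1 ^ 2 * Real.sin (2 * p.2) ^ (-c) =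
      ∑ k ∈ range (a₂ + 1), ∑ l ∈ range (a₁ + 1), ((a₂.choose k : ℝ) * (a₁.choose l : ℝ)) * term k l := by
    have e1 : ∀ p ∈ strip, (Dθ^[a₁] (Dz^[a₂] (u * Dθ g))) p.1 p.2 * Z p.1 p.2 * radialWeight p.1 ^ 2 * Real.sin (2 * p.2) ^ (-c) =
        ∑ k ∈ range (a₂ + 1), ∑ l ∈ range (a₁ + 1), ((a₂.choose k : ℝ) * (a₁.choose l : ℝ)) *
          ((Dθ^[l] (Dz^[k] u)) p.1 p.2 * (Dθ^[a₁ - l + 1] (Dz^[a₂ - k] g)) p.1 p.2 * Z p.1 p.2 * radialWeight p.1 ^ 2 * Real.sin (2 * p.2) ^ (-c)) := by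
      intro p hp
      rw [iterate_Dθ_Dz_mul_apply hu.smooth hg.ofDθ.smooth a₁ a₂ p.1 p.2, Finset.sum_mul, Finset.sum_mul, Finset.sum_mul]
      refine Finset.sum_congr rfl fun k _ => ?_
      rw [Finset.sum_mul, Finset.sum_mul, Finset.sum_mul]
      refine Finset.sum_congr rfl fun l _ => ?_
      rw [word_Dθ_strip hg (a₁ - l) (a₂ - k) hp]; ring
    rw [setIntegral_congr_fun measurableSet_strip e1, integral_finsetSum _ fun k _ => ?_]
    · refine Finset.sum_congr rfl fun k _ => ?_
      rw [integral_finsetSum _ fun l _ => ?_]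
      · refine Finset.sum_congr rfl fun l _ => ?_
        rw [MeasureTheory.integral_const_mul]
      · exact ((integrable_XYZW (hu.ofWord l k) (hg.ofWord _ _) (hg.ofWord a₁ a₂) c).const_mul _)
    · exact integrable_finsetSum _ fun l _ => ((integrable_XYZW (hu.ofWord l k) (hg.ofWord _ _) (hg.ofWord a₁ a₂) c).const_mul _)
  -- every term is bounded by `(3/2 + |1−c|)·S·Eg`
  have hbd : ∀ k ∈ range (a₂ + 1), ∀ l ∈ range (a₁ + 1), |term k l| ≤ (3 / 2 + |1 - c|) * S * Eg := by
    intro k hk l hl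
    have hk' : k ≤ a₂ := Nat.lt_succ_iff.1 (mem_range.1 hk)
    have hl' : l ≤ a₁ := Nat.lt_succ_iff.1 (mem_range.1 hl)
    by_cases h00 : l = 0 ∧ k = 0
    · obtain ⟨rfl, rfl⟩ := h00
      have h := abs_integral_ibp_Dθ_le hα hα10 hu hg ha hc hgood
      have e : term 0 0 = ∫ p in strip, u p.1 p.2 * Dθ (Dθ^[a₁] (Dz^[a₂] g)) p.1 p.2 * (Dθ^[a₁] (Dz^[a₂] g)) p.1 p.2 * radialWeight p.1 ^ 2 * Real.sin (2 * p.2) ^ (-c) := by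
        simp only [hterm, hZ, Nat.sub_zero, Function.iterate_zero, id_eq, Function.iterate_succ_apply']
      rw [e]
      refine h.trans ?_
      have : (1 / 2 + |1 - c|) * S * Eg ≤ (3 / 2 + |1 - c|) * S * Eg := by
        apply mul_le_mul_of_nonneg_right (mul_le_mul_of_nonneg_right (by linarith) hS0) hEg0
      exact this
    · have h := abs_integral_cross_le hα hα10 hu hg ha hl' hk' h00 hc hgood
      refine h.trans ?_
      have e : Real.sqrt (π / (3 * (gammaExp α - 1)) * (eHkNormSq α 4 u).toReal * (eHkNormSq α 4 g).toReal) * Real.sqrt (eHkNormSq α 4 g).toReal = S * Eg := by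
        rw [Real.sqrt_mul' _ hEg0, mul_assoc, Real.mul_self_sqrt hEg0]
      rw [e]
      have : S * Eg = 1 * S * Eg := by ring
      rw [this]
      exact mul_le_mul_of_nonneg_right (mul_le_mul_of_nonneg_right (by linarith [abs_nonneg (1 - c)]) hS0) hEg0
  rw [hexp]
  calc |∑ k ∈ range (a₂ + 1), ∑ l ∈ range (a₁ + 1), ((a₂.choose k : ℝ) * (a₁.choose l : ℝ)) * term k l|
      ≤ ∑ k ∈ range (a₂ + 1), ∑ l ∈ range (a₁ + 1), |((a₂.choose k : ℝ) * (a₁.choose l : ℝ)) * term k l| := by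
        refine (Finset.abs_sum_le_sum_abs _ _).trans (Finset.sum_le_sum fun k _ => Finset.abs_sum_le_sum_abs _ _)
    _ ≤ ∑ k ∈ range (a₂ + 1), ∑ l ∈ range (a₁ + 1), 256 * ((3 / 2 + |1 - c|) * S * Eg) := by
        refine Finset.sum_le_sum fun k hk => Finset.sum_le_sum fun l hl => ?_
        rw [abs_mul]
        refine mul_le_mul ?_ (hbd k hk l hl) (abs_nonneg _) (by norm_num)
        rw [abs_of_nonneg (by positivity)]
        calc (a₂.choose k : ℝ) * (a₁.choose l : ℝ) ≤ 16 * 16 := mul_le_mul (choose_le_sixteen (by omega)) (choose_le_sixteen (by omega)) (by positivity) (by norm_num)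
          _ = 256 := by norm_num
    _ = ((a₂ + 1 : ℕ) : ℝ) * (((a₁ + 1 : ℕ) : ℝ) * (256 * ((3 / 2 + |1 - c|) * S * Eg))) := by
        rw [Finset.sum_const, Finset.card_range, nsmul_eq_mul, Finset.sum_const, Finset.card_range, nsmul_eq_mul]
    _ ≤ 5 * (5 * (256 * ((5 / 2) * S * Eg))) := by
        have h5a : ((a₂ + 1 : ℕ) : ℝ) ≤ 5 := by exact_mod_cast (by omega : a₂ + 1 ≤ 5)
        have h5b : ((a₁ + 1 : ℕ) : ℝ) ≤ 5 := by exact_mod_cast (by omega : a₁ + 1 ≤ 5)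
        have hin : (3 / 2 + |1 - c|) * S * Eg ≤ 5 / 2 * S * Eg :=
          mul_le_mul_of_nonneg_right (mul_le_mul_of_nonneg_right (by linarith) hS0) hEg0
        have h0 : 0 ≤ (3 / 2 + |1 - c|) * S * Eg := by positivity
        calc ((a₂ + 1 : ℕ) : ℝ) * (((a₁ + 1 : ℕ) : ℝ) * (256 * ((3 / 2 + |1 - c|) * S * Eg)))
            ≤ 5 * (5 * (256 * ((3 / 2 + |1 - c|) * S * Eg))) := by
              refine mul_le_mul h5a (mul_le_mul h5b le_rfl (by positivity) (by norm_num)) (by positivity) (by norm_num)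
          _ ≤ 5 * (5 * (256 * ((5 / 2) * S * Eg))) := by nlinarith
    _ = 16000 * S * Eg := by ring

/-! ### The `𝓗⁴`-type inner products `hkForm α 3 λ Λ` -/

omit hα hα10 hu hg in
/-- `D_z` of a word on the strip is the next word: `D_z(D_θ^iD_z^jF) = D_θ^iD_z^{j+1}F` for `F` smooth. [folklore] -/
theorem Dz_word_strip {F : ℝ → ℝ → ℝ} (hF : StripTest F) (i j : ℕ) {p : ℝ × ℝ} (hp : p ∈ strip) :
    Dz (Dθ^[i] (Dz^[j] F)) p.1 p.2 = (Dθ^[i] (Dz^[j + 1] F)) p.1 p.2 := by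
  have h := Dz_iterate_Dθ (g := Dz^[j] F) (N := i + 2) (((hF.ofWord 0 j).contDiffOn (i + 2))) (i := i) le_rfl p hp
  rw [h, Function.iterate_succ_apply']

/-- **EGM Proposition 9.4, first transport estimate, for test functions at `k = 4`**: for every
choice of the weights `λ, Λ` of the inner product `hkForm α 3 λ Λ` (the `𝓗⁴`-type inner products of
Elgindi's §6.3 / EGM's Proposition 3.2) and `0 < α ≤ 10`,
`|(uD_θg, g)| ≤ C(λ,Λ)·16000·√((π/(3(γ−1)))|u|²_{𝓗⁴})·|g|²_{𝓗⁴}`. [cite: ElgindiGhoulMasmoudi2021, §9 Proposition 9.4 (p. 20 of arXiv:1910.14071); Elgindi2021, §8.1 Lemma 8.7 (p. 26 of arXiv:1904.04795)] -/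
theorem abs_hkForm_transport_Dθ_le (lam Lam : ℕ × ℕ → ℝ) :
    |hkForm α 3 lam Lam (u * Dθ g) g| ≤
      (∑ w ∈ WSet 3 3, |lam w| * (10 + |Lam w| * (10 ^ 10 + 10 ^ 17 + 10 ^ 21))) *
        (16000 * Real.sqrt (π / (3 * (gammaExp α - 1)) * (eHkNormSq α 4 u).toReal) * (eHkNormSq α 4 g).toReal) := by
  set B := 16000 * Real.sqrt (π / (3 * (gammaExp α - 1)) * (eHkNormSq α 4 u).toReal) * (eHkNormSq α 4 g).toReal with hB
  have hB0 : 0 ≤ B := by positivity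
  set F := u * Dθ g with hF
  have hFt : StripTest F := hu.mul hg.ofDθ
  have hη : (eta : ℝ) = 0 ∨ eta = eta ∨ eta = gammaExp α := Or.inr (Or.inl rfl)
  have hγ' : gammaExp α = 0 ∨ gammaExp α = eta ∨ gammaExp α = gammaExp α := Or.inr (Or.inr rfl)
  have h0' : (0:ℝ) = 0 ∨ (0:ℝ) = eta ∨ (0:ℝ) = gammaExp α := Or.inl rfl
  have hne : ∀ {c : ℝ}, c = eta → c = gammaExp α → False := fun h1 h2 => by
    rw [h1] at h2; unfold eta gammaExp at h2; linarith
  -- the four pairings of a block, as word pairings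
  have hblock : ∀ w ∈ WSet 3 3, |blockΛ α (Lam w) (Dθ^[w.1] (Dz^[w.2] F)) (Dθ^[w.1] (Dz^[w.2] g))| ≤ (10 + |Lam w| * (10 ^ 10 + 10 ^ 17 + 10 ^ 21)) * B := by
    intro w hw
    rw [mem_WSet_self] at hw
    obtain ⟨i, j⟩ := w
    simp only at hw ⊢
    -- (1) the `D_z`-extended `η`-pairing: word `(i, j+1)`
    have T1 : |pairW wEta (Dz (Dθ^[i] (Dz^[j] F))) (Dz (Dθ^[i] (Dz^[j] g)))| ≤ B := by
      have h := abs_wordPairing_Dθ_le hα hα10 hu hg (a₁ := i) (a₂ := j + 1) (by omega) hη (fun h => (hne rfl h).elim)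
      rw [pairW_def]
      refine le_of_eq_of_le ?_ h
      congr 1
      refine setIntegral_congr_fun measurableSet_strip fun p hp => ?_
      rw [Dz_word_strip hFt i j hp, Dz_word_strip hg i j hp]; rfl
    -- (2) the `η`-pairing: word `(i, j)`
    have T2 : |pairW wEta (Dθ^[i] (Dz^[j] F)) (Dθ^[i] (Dz^[j] g))| ≤ B := by
      have h := abs_wordPairing_Dθ_le hα hα10 hu hg (a₁ := i) (a₂ := j) (by omega) hη (fun h => (hne rfl h).elim)
      rw [pairW_def]; exact h
    -- (3) the unweighted pairing: word `(i, j)`, `c = 0`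
    have T3 : |pairW (fun _ => (1:ℝ)) (Dθ^[i] (Dz^[j] F)) (Dθ^[i] (Dz^[j] g))| ≤ B := by
      have h := abs_wordPairing_Dθ_le hα hα10 hu hg (a₁ := i) (a₂ := j) (by omega) h0' (fun h => by unfold gammaExp at h; linarith)
      rw [pairW_def]
      refine le_of_eq_of_le ?_ h
      congr 1
      refine setIntegral_congr_fun measurableSet_strip fun p _ => ?_
      rw [neg_zero, Real.rpow_zero]
    -- (4) the `D_θ`-extended `γ`-pairing: word `(i+1, j)`
    have T4 : |pairW (wGam α) (Dθ (Dθ^[i] (Dz^[j] F))) (Dθ (Dθ^[i] (Dz^[j] g)))| ≤ B := by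
      have h := abs_wordPairing_Dθ_le hα hα10 hu hg (a₁ := i + 1) (a₂ := j) (by omega) hγ' (fun _ => by omega)
      rw [pairW_def]
      refine le_of_eq_of_le ?_ h
      congr 1
      refine setIntegral_congr_fun measurableSet_strip fun p _ => ?_
      simp only [wGam, Function.iterate_succ_apply', hF]
    rw [blockΛ_def]
    have hΛ := abs_nonneg (Lam (i, j))
    calc |10 * pairW wEta (Dz (Dθ^[i] (Dz^[j] F))) (Dz (Dθ^[i] (Dz^[j] g))) +
          Lam (i, j) * (10 ^ 10 * pairW wEta (Dθ^[i] (Dz^[j] F)) (Dθ^[i] (Dz^[j] g)) + 10 ^ 17 * pairW (fun _ => 1) (Dθ^[i] (Dz^[j] F)) (Dθ^[i] (Dz^[j] g)) +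
            10 ^ 21 * pairW (wGam α) (Dθ (Dθ^[i] (Dz^[j] F))) (Dθ (Dθ^[i] (Dz^[j] g))))|
        ≤ 10 * |pairW wEta (Dz (Dθ^[i] (Dz^[j] F))) (Dz (Dθ^[i] (Dz^[j] g)))| +
          |Lam (i, j)| * (10 ^ 10 * |pairW wEta (Dθ^[i] (Dz^[j] F)) (Dθ^[i] (Dz^[j] g))| + 10 ^ 17 * |pairW (fun _ => 1) (Dθ^[i] (Dz^[j] F)) (Dθ^[i] (Dz^[j] g))| +
            10 ^ 21 * |pairW (wGam α) (Dθ (Dθ^[i] (Dz^[j] F))) (Dθ (Dθ^[i] (Dz^[j] g)))|) := by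
          refine (abs_add_le _ _).trans (add_le_add ?_ ?_)
          · rw [abs_mul, show |(10:ℝ)| = 10 by norm_num]
          · rw [abs_mul]
            refine mul_le_mul_of_nonneg_left ((abs_add_le _ _).trans (add_le_add ((abs_add_le _ _).trans (add_le_add ?_ ?_)) ?_)) hΛ
            · rw [abs_mul, abs_of_pos (by positivity : (0:ℝ) < 10 ^ 10)]
            · rw [abs_mul, abs_of_pos (by positivity : (0:ℝ) < 10 ^ 17)]
            · rw [abs_mul, abs_of_pos (by positivity : (0:ℝ) < 10 ^ 21)]
      _ ≤ 10 * B + |Lam (i, j)| * (10 ^ 10 * B + 10 ^ 17 * B + 10 ^ 21 * B) := by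
          gcongr
      _ = (10 + |Lam (i, j)| * (10 ^ 10 + 10 ^ 17 + 10 ^ 21)) * B := by ring
  unfold hkForm
  calc |∑ w ∈ WSet 3 3, lam w * blockΛ α (Lam w) (Dθ^[w.1] (Dz^[w.2] F)) (Dθ^[w.1] (Dz^[w.2] g))|
      ≤ ∑ w ∈ WSet 3 3, |lam w * blockΛ α (Lam w) (Dθ^[w.1] (Dz^[w.2] F)) (Dθ^[w.1] (Dz^[w.2] g))| := Finset.abs_sum_le_sum_abs _ _
    _ ≤ ∑ w ∈ WSet 3 3, |lam w| * ((10 + |Lam w| * (10 ^ 10 + 10 ^ 17 + 10 ^ 21)) * B) := by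
        refine Finset.sum_le_sum fun w hw => ?_
        rw [abs_mul]
        exact mul_le_mul_of_nonneg_left (hblock w hw) (abs_nonneg _)
    _ = (∑ w ∈ WSet 3 3, |lam w| * (10 + |Lam w| * (10 ^ 10 + 10 ^ 17 + 10 ^ 21))) * B := by
        rw [Finset.sum_mul]; refine Finset.sum_congr rfl fun w _ => by ring

end pieces

end Elgindi

end Literature.Analysis.FluidPDE
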